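import Literature.MathematicalPhysics.QuantumManyBody.GroundStateFeynmanKacCutLine
import Literature.MathematicalPhysics.QuantumManyBody.GroundStateFeynmanKacOperatorProps
import Summits.AtomisticToContinuum.BoseEinsteinCondensation.Theorems.BECCutLineWeakDisorderWitnessTransferConvergence
import Mathlib.Analysis.SpecificLimits.Basic
import HarnessLib

/-!
# Route BECCutLineWeakDisorder — `WitnessTransfer`, line `Sketch`, stub (B): the integrated
eigen-inequality of the finite-`T` witness at finite `T`

Support file (does not close the item) for item stmt-AtomisticToContinuum-14978
(`Summit.AtomisticToContinuum.BoseEinsteinCondensation.Theses.BECCutLineWeakDisorder.WitnessTransfer`).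

For a GENERAL measurable pair potential `v : ℝ → [0, ∞]` (hard cores allowed; no ground state, no
spectral theorem) write `Z(s) = fkNormSq v L s 1 = ‖e^{-sH_N}1‖₂² = ⟨1, e^{-2sH_N}1⟩` for the
partition norm of the Dirichlet `N`-body problem in the box `Λ_L^N`, and
`Ψ_T = fkWitness v L T 1 = e^{-TH_N}1/‖e^{-TH_N}1‖₂` for the finite-`T` Feynman–Kac witness. Then

* `fkNormSq_one_antitone` — `Z` is antitone on `[0, ∞)` (`e^{-(a+b)H}1 = e^{-aH}(e^{-bH}1) ≤ e^{-aH}1`);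
* `fkNormSq_one_midpoint_sq_le` — **midpoint log-convexity** `Z((a+b)/2)² ≤ Z(a) Z(b)`
  (`Z((a+b)/2) = ⟨e^{-aH}1, e^{-bH}1⟩` by symmetry and the semigroup law, then Cauchy–Schwarz);
* `fkNormSq_one_ne_zero` — `Z(T) ≠ 0` for one `T > 0` forces `Z(s) ≠ 0` for all `s ≥ 0`;
* `convexSeq_three_point` — the discrete three-point inequality for convex sequences,
  `(n + i) b n ≤ i b 0 + n b (n + i)`;
* `logConvex_slope_ineq` — for a midpoint-convex, antitone `ℓ` on `[0, ∞)`: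
  `ℓ(T + t/2) - ℓ(T) ≥ -t (ℓ 0 - ℓ T)/(2T)` (three-point inequality on the grids `T/n · ℕ`,
  monotonicity to reach real `t`, and `n → ∞`);
* `integral_fkWitness_mul_fkReal` — the pairing `⟨Ψ_T, e^{-tH}Ψ_T⟩ = Z(T + t/2)/Z(T)`;
* `stub_heig` — **the integrated eigen-inequality** `⟨Ψ_T, e^{-tH}Ψ_T⟩ ≥ e^{-t E_T}` with the
  slope energy `E_T = log(Z(0)/Z(T))/(2T)`, for every `t > 0`.

## References

* B. Simon, *Schrödinger semigroups*, Bull. AMS 7 (1982), §A1 (A7) (the approximants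
  `e^{-tH}f/(f, e^{-2tH}f)^{1/2}`). [Simon1982]
* K. L. Chung, Z. Zhao, *From Brownian Motion to Schrödinger's Equation* (1995), §3.2 (semigroup
  law), Thm 3.10 (symmetry). [ChungZhao1995]
-/

noncomputable section

open MeasureTheory Filter Set Metric
open scoped ENNReal NNReal Topology

namespace Summit.AtomisticToContinuum.BoseEinsteinCondensation.Theorems.CutLineWitness

open Literature.MathematicalPhysics.QuantumManyBody.BoseGas

variable {N : ℕ}

/-! ### Monotonicity and log-convexity of the partition norm `Z(s) = ‖e^{-sH_N}1‖₂²` -/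

/-- `e^{-(a+b)H_N}1 = e^{-aH_N}(e^{-bH_N}1) ≤ e^{-aH_N}1` pointwise (`a, b ≥ 0`): the semigroup law and
the sub-Markov bound `e^{-bH_N}1 ≤ 1`. [folklore] -/
theorem fkSemigroup_one_add_le {v : ℝ → ℝ≥0∞} (hv : Measurable v) (L : ℝ) {a b : ℝ}
    (ha : 0 ≤ a) (hb : 0 ≤ b) (X : Config N) :
    fkSemigroup v L (a + b) (fun _ => (1 : ℝ≥0∞)) X ≤
      fkSemigroup v L a (fun _ => (1 : ℝ≥0∞)) X := by
  rw [fkSemigroup_add hv L ha hb measurable_const X]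
  exact fkSemigroup_mono v L a (fun Y => fkPartition_le_one v L b Y) X

/-- **`Z` is antitone**: `‖e^{-bH_N}1‖₂² ≤ ‖e^{-aH_N}1‖₂²` for `0 ≤ a ≤ b`. [folklore] -/
theorem fkNormSq_one_antitone {v : ℝ → ℝ≥0∞} (hv : Measurable v) (L : ℝ) {a b : ℝ}
    (ha : 0 ≤ a) (hab : a ≤ b) :
    fkNormSq (N := N) v L b (fun _ => (1 : ℝ≥0∞)) ≤ fkNormSq (N := N) v L a (fun _ => (1 : ℝ≥0∞)) := by
  rw [fkNormSq, fkNormSq]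
  refine lintegral_mono fun X => ?_
  have h := fkSemigroup_one_add_le (N := N) hv L ha (sub_nonneg.2 hab) X
  rw [add_sub_cancel] at h
  exact pow_le_pow_left' h 2

/-- **Midpoint log-convexity of the partition norm**: `Z((a+b)/2)² ≤ Z(a) Z(b)` for `a, b ≥ 0`,
where `Z(s) = ‖e^{-sH_N}1‖₂²`. Indeed `Z((a+b)/2) = ⟨1, e^{-(a+b)H_N}1⟩ = ⟨e^{-bH_N}1, e^{-aH_N}1⟩`
(semigroup law and symmetry of the Feynman–Kac functional), and Cauchy–Schwarz.
[cite: Simon1982, §A1 (A7) p. 449] -/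
theorem fkNormSq_one_midpoint_sq_le {v : ℝ → ℝ≥0∞} (hv : Measurable v) (L : ℝ) {a b : ℝ}
    (ha : 0 ≤ a) (hb : 0 ≤ b) :
    fkNormSq (N := N) v L ((a + b) / 2) (fun _ => (1 : ℝ≥0∞)) ^ 2 ≤
      fkNormSq (N := N) v L a (fun _ => (1 : ℝ≥0∞)) *
        fkNormSq (N := N) v L b (fun _ => (1 : ℝ≥0∞)) := by
  have h1m : Measurable (fun _ : Config N => (1 : ℝ≥0∞)) := measurable_const
  have ham : Measurable (fkSemigroup v L a fun _ : Config N => (1 : ℝ≥0∞)) :=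
    measurable_fkSemigroup hv L a h1m
  have hbm : Measurable (fkSemigroup v L b fun _ : Config N => (1 : ℝ≥0∞)) :=
    measurable_fkSemigroup hv L b h1m
  -- `Z((a+b)/2) = ∫ (e^{-bH}1)(e^{-aH}1)`
  have hrepr : fkNormSq (N := N) v L ((a + b) / 2) (fun _ => (1 : ℝ≥0∞)) =
      ∫⁻ X : Config N, fkSemigroup v L b (fun _ => (1 : ℝ≥0∞)) X *
        fkSemigroup v L a (fun _ => (1 : ℝ≥0∞)) X := by
    rw [fkNormSq_eq hv L (by linarith) h1m, show 2 * ((a + b) / 2) = a + b by ring]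
    simp_rw [fkSemigroup_add hv L ha hb h1m]
    exact lintegral_mul_fkSemigroup_comm hv L ha h1m hbm
  -- Cauchy–Schwarz
  have hcs := ENNReal.lintegral_mul_le_Lp_mul_Lq volume Real.HolderConjugate.two_two
    hbm.aemeasurable ham.aemeasurable
  have hhalf : ∀ x : ℝ≥0∞, (x ^ (1 / 2 : ℝ)) ^ 2 = x := fun x => by
    rw [← ENNReal.rpow_two, ← ENNReal.rpow_mul]
    norm_num
  have hsq : ∀ s : ℝ, (∫⁻ X : Config N, fkSemigroup v L s (fun _ => (1 : ℝ≥0∞)) X ^ (2 : ℝ)) =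
      fkNormSq (N := N) v L s (fun _ => (1 : ℝ≥0∞)) := fun s => by
    rw [fkNormSq]
    exact lintegral_congr fun X => ENNReal.rpow_two _
  calc fkNormSq (N := N) v L ((a + b) / 2) (fun _ => (1 : ℝ≥0∞)) ^ 2
      = (∫⁻ X : Config N, fkSemigroup v L b (fun _ => (1 : ℝ≥0∞)) X *
          fkSemigroup v L a (fun _ => (1 : ℝ≥0∞)) X) ^ 2 := by rw [hrepr]
    _ ≤ ((∫⁻ X : Config N, fkSemigroup v L b (fun _ => (1 : ℝ≥0∞)) X ^ (2 : ℝ)) ^ (1 / 2 : ℝ) *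
          (∫⁻ X : Config N, fkSemigroup v L a (fun _ => (1 : ℝ≥0∞)) X ^ (2 : ℝ)) ^
            (1 / 2 : ℝ)) ^ 2 :=
        pow_le_pow_left' hcs 2
    _ = fkNormSq (N := N) v L a (fun _ => (1 : ℝ≥0∞)) *
          fkNormSq (N := N) v L b (fun _ => (1 : ℝ≥0∞)) := by
        rw [mul_pow, hhalf, hhalf, hsq, hsq, mul_comm]

/-- **Positivity propagates**: if `Z(T) = ‖e^{-TH_N}1‖₂² ≠ 0` for one `T > 0` then `Z(s) ≠ 0` for
every `s ≥ 0` (for `s ≤ T` by monotonicity; beyond, `Z(s) = 0` would force `Z(s/2) = 0` by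
midpoint log-convexity, and so on down to `[0, T]`). [folklore] -/
theorem fkNormSq_one_ne_zero {v : ℝ → ℝ≥0∞} (hv : Measurable v) (L : ℝ) {T : ℝ} (hT : 0 < T)
    (h0 : fkNormSq (N := N) v L T (fun _ => (1 : ℝ≥0∞)) ≠ 0) {s : ℝ} (hs : 0 ≤ s) :
    fkNormSq (N := N) v L s (fun _ => (1 : ℝ≥0∞)) ≠ 0 := by
  have key : ∀ k : ℕ, ∀ s : ℝ, 0 ≤ s → s ≤ (k + 1) * T →
      fkNormSq (N := N) v L s (fun _ => (1 : ℝ≥0∞)) ≠ 0 := by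
    intro k
    induction k with
    | zero =>
      intro s hs hsT h
      rw [Nat.cast_zero, zero_add, one_mul] at hsT
      exact h0 (le_antisymm ((fkNormSq_one_antitone hv L hs hsT).trans_eq h) bot_le)
    | succ k ih =>
      intro s hs hsT h
      have hkT : (0 : ℝ) ≤ k * T := mul_nonneg (Nat.cast_nonneg k) hT.le
      have h2 : s / 2 ≤ (k + 1) * T := by
        push_cast at hsT
        linarith
      have hmid := fkNormSq_one_midpoint_sq_le (N := N) hv L le_rfl hs
      rw [h, mul_zero, nonpos_iff_eq_zero, pow_eq_zero_iff two_ne_zero, zero_add] at hmid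
      exact ih (s / 2) (by linarith) h2 hmid
  obtain ⟨k, hk⟩ := exists_nat_gt (s / T)
  refine key k s hs ?_
  have h1 : s / T * T = s := div_mul_cancel₀ s hT.ne'
  nlinarith [hk, hT]

/-! ### The discrete three-point inequality and its continuum consequence -/

/-- **Three-point inequality for convex sequences**: if `2 b (j+1) ≤ b j + b (j+2)` for all `j`,
then `(n + i) b n ≤ i b 0 + n b (n + i)` (the increments `b (j+1) - b j` are nondecreasing, so
`b n - b 0 ≤ n (b (n+1) - b n)` and `i (b (n+1) - b n) ≤ b (n+i) - b n`). [folklore] -/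
theorem convexSeq_three_point {b : ℕ → ℝ} (hb : ∀ j, 2 * b (j + 1) ≤ b j + b (j + 2)) (n i : ℕ) :
    ((n : ℝ) + i) * b n ≤ i * b 0 + n * b (n + i) := by
  have hd : Monotone fun j => b (j + 1) - b j := by
    refine monotone_nat_of_le_succ fun j => ?_
    have h := hb j
    rw [show j + 2 = j + 1 + 1 from rfl] at h
    linarith
  have h1 : b n - b 0 ≤ n * (b (n + 1) - b n) := by
    rw [← Finset.sum_range_sub b n]
    calc ∑ j ∈ Finset.range n, (b (j + 1) - b j)
        ≤ ∑ _j ∈ Finset.range n, (b (n + 1) - b n) :=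
          Finset.sum_le_sum fun j hj => hd (Finset.mem_range.1 hj).le
      _ = n * (b (n + 1) - b n) := by
          rw [Finset.sum_const, Finset.card_range, nsmul_eq_mul]
  have h2 : (i : ℝ) * (b (n + 1) - b n) ≤ b (n + i) - b n := by
    have hs := Finset.sum_range_sub (fun j => b (n + j)) i
    simp only [add_zero] at hs
    rw [← hs]
    calc (i : ℝ) * (b (n + 1) - b n) = ∑ _j ∈ Finset.range i, (b (n + 1) - b n) := by
          rw [Finset.sum_const, Finset.card_range, nsmul_eq_mul]
      _ ≤ ∑ j ∈ Finset.range i, (b (n + (j + 1)) - b (n + j)) :=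
          Finset.sum_le_sum fun j _ => hd (Nat.le_add_right n j)
  have hn : (0 : ℝ) ≤ n := Nat.cast_nonneg n
  have hi : (0 : ℝ) ≤ i := Nat.cast_nonneg i
  nlinarith [mul_le_mul_of_nonneg_left h1 hi, mul_le_mul_of_nonneg_left h2 hn]

/-- **From midpoint log-convexity to the slope bound.** If `ℓ : ℝ → ℝ` is midpoint-convex and
antitone on `[0, ∞)`, then for `T, t > 0`:
`ℓ(T + t/2) - ℓ(T) ≥ -t · (ℓ 0 - ℓ T)/(2T)` (the three-point inequality on the grids of mesh `T/n`
gives it for `t/2 ∈ (T/n)ℕ`; a general `t` is reached from the next grid point above by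
monotonicity, at the cost `(ℓ 0 - ℓ T)/n → 0`). [folklore] -/
theorem logConvex_slope_ineq {ℓ : ℝ → ℝ}
    (hmid : ∀ a b : ℝ, 0 ≤ a → 0 ≤ b → 2 * ℓ ((a + b) / 2) ≤ ℓ a + ℓ b)
    (hanti : ∀ a b : ℝ, 0 ≤ a → a ≤ b → ℓ b ≤ ℓ a) {T t : ℝ} (hT : 0 < T) (ht : 0 < t) :
    -((ℓ 0 - ℓ T) / (2 * T) * t) ≤ ℓ (T + t / 2) - ℓ T := by
  have hC0 : 0 ≤ ℓ 0 - ℓ T := sub_nonneg.2 (hanti 0 T le_rfl hT.le)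
  -- the discrete version on the grid of mesh `T / n`
  have hgrid : ∀ n : ℕ, 0 < n → ∀ i : ℕ,
      -((i : ℝ) / n * (ℓ 0 - ℓ T)) ≤ ℓ (T + i * (T / n)) - ℓ T := by
    intro n hn i
    have hn' : (0 : ℝ) < n := Nat.cast_pos.2 hn
    have hh0 : 0 ≤ T / n := div_nonneg hT.le hn'.le
    have hb : ∀ j : ℕ, 2 * ℓ (((j + 1 : ℕ) : ℝ) * (T / n)) ≤
        ℓ ((j : ℝ) * (T / n)) + ℓ (((j + 2 : ℕ) : ℝ) * (T / n)) := by
      intro j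
      have hm := hmid ((j : ℝ) * (T / n)) (((j + 2 : ℕ) : ℝ) * (T / n))
        (mul_nonneg (Nat.cast_nonneg j) hh0) (mul_nonneg (Nat.cast_nonneg _) hh0)
      have e : ((j : ℝ) * (T / n) + ((j + 2 : ℕ) : ℝ) * (T / n)) / 2 =
          ((j + 1 : ℕ) : ℝ) * (T / n) := by
        push_cast
        ring
      rwa [e] at hm
    have h3 : ((n : ℝ) + i) * ℓ ((n : ℝ) * (T / n)) ≤
        i * ℓ (((0 : ℕ) : ℝ) * (T / n)) + n * ℓ (((n + i : ℕ) : ℝ) * (T / n)) :=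
      convexSeq_three_point (b := fun j : ℕ => ℓ ((j : ℝ) * (T / n))) hb n i
    have e1 : (n : ℝ) * (T / n) = T := by field_simp
    have e2 : ((n + i : ℕ) : ℝ) * (T / n) = T + i * (T / n) := by
      push_cast
      rw [add_mul, e1]
    have e0 : ((0 : ℕ) : ℝ) * (T / n) = 0 := by simp
    rw [e0, e1, e2] at h3
    have key : -((i : ℝ) * (ℓ 0 - ℓ T)) ≤ (ℓ (T + i * (T / n)) - ℓ T) * n := by nlinarith [h3]
    rw [show -((i : ℝ) / n * (ℓ 0 - ℓ T)) = -((i : ℝ) * (ℓ 0 - ℓ T)) / n by ring,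
      div_le_iff₀ hn']
    exact key
  -- every `n ≥ 1`: compare with the next grid point above `t / 2`
  have hstep : ∀ n : ℕ, 0 < n →
      -((ℓ 0 - ℓ T) / (2 * T) * t) - (ℓ 0 - ℓ T) / n ≤ ℓ (T + t / 2) - ℓ T := by
    intro n hn
    have hn' : (0 : ℝ) < n := Nat.cast_pos.2 hn
    have hx0 : 0 ≤ t * n / (2 * T) := by positivity
    obtain ⟨i, hi⟩ : ∃ i : ℕ, i = ⌊t * n / (2 * T)⌋₊ + 1 := ⟨_, rfl⟩
    have hi1 : t * n / (2 * T) < i := by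
      rw [hi]
      push_cast
      exact Nat.lt_floor_add_one _
    have hi2 : (i : ℝ) ≤ t * n / (2 * T) + 1 := by
      rw [hi]
      push_cast
      linarith [Nat.floor_le hx0]
    -- `T + t/2 ≤ T + i T/n`
    have hle : T + t / 2 ≤ T + i * (T / n) := by
      have h1 : t * n < i * (2 * T) := (div_lt_iff₀ (by positivity)).1 hi1
      have h2 : t / 2 ≤ i * (T / n) := by
        rw [show (i : ℝ) * (T / n) = i * (2 * T) / (2 * n) by field_simp,
          le_div_iff₀ (by positivity)]
        nlinarith [h1]
      linarith
    have hmono := hanti (T + t / 2) (T + i * (T / n)) (by positivity) hle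
    have hg := hgrid n hn i
    -- `(i/n) (ℓ 0 - ℓ T) ≤ (t/(2T) + 1/n) (ℓ 0 - ℓ T)`
    have hcoef : (i : ℝ) / n * (ℓ 0 - ℓ T) ≤ (t / (2 * T) + 1 / n) * (ℓ 0 - ℓ T) := by
      refine mul_le_mul_of_nonneg_right ?_ hC0
      rw [div_le_iff₀ hn']
      calc (i : ℝ) ≤ t * n / (2 * T) + 1 := hi2
        _ = (t / (2 * T) + 1 / n) * n := by field_simp
    have e : (t / (2 * T) + 1 / n) * (ℓ 0 - ℓ T) =
        (ℓ 0 - ℓ T) / (2 * T) * t + (ℓ 0 - ℓ T) / n := by ring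
    linarith [hg, hmono, hcoef, e]
  -- `n → ∞`
  have hlim : Tendsto (fun n : ℕ => -((ℓ 0 - ℓ T) / (2 * T) * t) - (ℓ 0 - ℓ T) / n) atTop
      (𝓝 (-((ℓ 0 - ℓ T) / (2 * T) * t) - 0)) :=
    tendsto_const_nhds.sub (tendsto_const_div_atTop_nhds_zero_nat _)
  rw [sub_zero] at hlim
  exact le_of_tendsto hlim (Filter.eventually_atTop.2 ⟨1, fun n hn => hstep n hn⟩)

/-! ### The pairing `⟨Ψ_T, e^{-tH}Ψ_T⟩ = Z(T + t/2)/Z(T)` -/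

/-- **`⟨Ψ_T, e^{-tH_N}Ψ_T⟩ = Z(T + t/2)/Z(T)`** for `Ψ_T = e^{-TH_N}1/‖e^{-TH_N}1‖₂`, `Z(s) = ‖e^{-sH_N}1‖₂²`,
`T, t ≥ 0`, `Z(T) ≠ 0`: `Ψ_T = Z(T)^{-1/2} e^{-TH_N}1`, `e^{-tH_N}Ψ_T = Z(T)^{-1/2} e^{-(t+T)H_N}1`,
and `∫ (e^{-TH_N}1)(e^{-(T+t)H_N}1) = ⟨1, e^{-(2T+t)H_N}1⟩ = Z(T + t/2)` by symmetry and the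
semigroup law. [cite: Simon1982, §A1 (A7) p. 449] -/
theorem integral_fkWitness_mul_fkReal {v : ℝ → ℝ≥0∞} (hv : Measurable v) (L : ℝ) {T : ℝ}
    (hT : 0 ≤ T) (h0 : fkNormSq (N := N) v L T (fun _ => (1 : ℝ≥0∞)) ≠ 0) {t : ℝ} (ht : 0 ≤ t) :
    ∫ X, fkWitness (N := N) v L T (fun _ => (1 : ℝ≥0∞)) X *
        fkReal v L t (fkWitness (N := N) v L T (fun _ => (1 : ℝ≥0∞))) X =
      (fkNormSq (N := N) v L (T + t / 2) (fun _ => (1 : ℝ≥0∞))).toReal /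
        (fkNormSq (N := N) v L T (fun _ => (1 : ℝ≥0∞))).toReal := by
  have hZt : fkNormSq (N := N) v L T (fun _ => (1 : ℝ≥0∞)) ≠ ⊤ :=
    ne_top_of_le_ne_top (volume_boxN_lt_top N L).ne (fkNormSq_one_le v hT)
  have hz : 0 < (fkNormSq (N := N) v L T (fun _ => (1 : ℝ≥0∞))).toReal := ENNReal.toReal_pos h0 hZt
  obtain ⟨κ, hκ⟩ : ∃ κ : ℝ,
      κ = (Real.sqrt (fkNormSq (N := N) v L T (fun _ => (1 : ℝ≥0∞))).toReal)⁻¹ := ⟨_, rfl⟩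
  have hκ0 : 0 ≤ κ := by
    rw [hκ]
    positivity
  have hκ2 : κ ^ 2 = ((fkNormSq (N := N) v L T (fun _ => (1 : ℝ≥0∞))).toReal)⁻¹ := by
    rw [hκ, inv_pow, Real.sq_sqrt hz.le]
  have h1m : Measurable (fun _ : Config N => (1 : ℝ≥0∞)) := measurable_const
  have hS : ∀ (s : ℝ) (X : Config N), fkSemigroup v L s (fun _ : Config N => (1 : ℝ≥0∞)) X ≠ ⊤ :=
    fun s X => ((fkPartition_le_one v L s X).trans_lt ENNReal.one_lt_top).ne
  -- `Ψ_T = κ · e^{-TH}1`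
  have hΨ : ∀ X, fkWitness v L T (fun _ => (1 : ℝ≥0∞)) X =
      κ * (fkSemigroup v L T (fun _ : Config N => (1 : ℝ≥0∞)) X).toReal := by
    intro X
    rw [fkWitness_apply, div_eq_mul_inv, ← hκ, mul_comm]
  have hΨ' : (fun Y => ENNReal.ofReal (fkWitness v L T (fun _ => (1 : ℝ≥0∞)) Y)) =
      fun Y => ((κ.toNNReal : ℝ≥0) : ℝ≥0∞) *
        fkSemigroup v L T (fun _ : Config N => (1 : ℝ≥0∞)) Y := by
    funext Y
    rw [hΨ Y, ENNReal.ofReal_mul hκ0, ENNReal.ofReal_toReal (hS T Y)]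
    rfl
  -- `e^{-tH}Ψ_T = κ · e^{-(t+T)H}1`
  have hR : ∀ X, fkReal v L t (fkWitness v L T (fun _ => (1 : ℝ≥0∞))) X =
      κ * (fkSemigroup v L (t + T) (fun _ : Config N => (1 : ℝ≥0∞)) X).toReal := by
    intro X
    rw [fkReal_eq_toReal_fkSemigroup hv L t (measurable_fkWitness hv L T h1m)
        (fkWitness_nonneg v L T _) X, hΨ',
      fkSemigroup_const_mul v L t κ.toNNReal (fkSemigroup v L T fun _ : Config N => (1 : ℝ≥0∞)) X,
      ← fkSemigroup_add hv L ht hT h1m X, ENNReal.toReal_mul, ENNReal.coe_toReal,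
      Real.coe_toNNReal _ hκ0]
  -- the integrand, pointwise
  have hpt : ∀ X, fkWitness v L T (fun _ => (1 : ℝ≥0∞)) X *
        fkReal v L t (fkWitness v L T (fun _ => (1 : ℝ≥0∞))) X =
      ((fkNormSq (N := N) v L T (fun _ => (1 : ℝ≥0∞))).toReal)⁻¹ *
        (fkSemigroup v L T (fun _ : Config N => (1 : ℝ≥0∞)) X *
          fkSemigroup v L (t + T) (fun _ : Config N => (1 : ℝ≥0∞)) X).toReal := by
    intro X
    rw [hR X, hΨ X, ENNReal.toReal_mul, ← hκ2]
    ring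
  -- `∫ (e^{-TH}1)(e^{-(t+T)H}1) = Z(T + t/2)`
  have hchain : ∫⁻ X, fkSemigroup v L T (fun _ : Config N => (1 : ℝ≥0∞)) X *
        fkSemigroup v L (t + T) (fun _ : Config N => (1 : ℝ≥0∞)) X =
      fkNormSq (N := N) v L (T + t / 2) (fun _ => (1 : ℝ≥0∞)) := by
    have hTm := measurable_fkSemigroup hv L T h1m
    have htm := measurable_fkSemigroup hv L t h1m
    have h2T : (0 : ℝ) ≤ 2 * T := by positivity
    calc ∫⁻ X, fkSemigroup v L T (fun _ : Config N => (1 : ℝ≥0∞)) X *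
          fkSemigroup v L (t + T) (fun _ : Config N => (1 : ℝ≥0∞)) X
        = ∫⁻ X, fkSemigroup v L T (fun _ : Config N => (1 : ℝ≥0∞)) X *
            fkSemigroup v L T (fkSemigroup v L t fun _ : Config N => (1 : ℝ≥0∞)) X := by
          refine lintegral_congr fun X => ?_
          rw [add_comm t T, fkSemigroup_add hv L hT ht h1m X]
      _ = ∫⁻ X, fkSemigroup v L t (fun _ : Config N => (1 : ℝ≥0∞)) X *
            fkSemigroup v L T (fkSemigroup v L T fun _ : Config N => (1 : ℝ≥0∞)) X :=
          lintegral_mul_fkSemigroup_comm hv L hT hTm htm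
      _ = ∫⁻ X, fkSemigroup v L t (fun _ : Config N => (1 : ℝ≥0∞)) X *
            fkSemigroup v L (2 * T) (fun _ : Config N => (1 : ℝ≥0∞)) X := by
          refine lintegral_congr fun X => ?_
          rw [two_mul, fkSemigroup_add hv L hT hT h1m X]
      _ = ∫⁻ X, (fun _ : Config N => (1 : ℝ≥0∞)) X *
            fkSemigroup v L (2 * T) (fkSemigroup v L t fun _ : Config N => (1 : ℝ≥0∞)) X :=
          lintegral_mul_fkSemigroup_comm hv L h2T htm h1m
      _ = ∫⁻ X, (fun _ : Config N => (1 : ℝ≥0∞)) X *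
            fkSemigroup v L (2 * (T + t / 2)) (fun _ : Config N => (1 : ℝ≥0∞)) X := by
          refine lintegral_congr fun X => ?_
          rw [show 2 * (T + t / 2) = 2 * T + t by ring, fkSemigroup_add hv L h2T ht h1m X]
      _ = fkNormSq (N := N) v L (T + t / 2) (fun _ => (1 : ℝ≥0∞)) :=
          (fkNormSq_eq hv L (by positivity) h1m).symm
  have hmeas : AEMeasurable (fun X => fkSemigroup v L T (fun _ : Config N => (1 : ℝ≥0∞)) X *
      fkSemigroup v L (t + T) (fun _ : Config N => (1 : ℝ≥0∞)) X) volume :=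
    ((measurable_fkSemigroup hv L T h1m).mul (measurable_fkSemigroup hv L (t + T) h1m)).aemeasurable
  have hfin : ∀ᵐ X : Config N ∂volume, fkSemigroup v L T (fun _ : Config N => (1 : ℝ≥0∞)) X *
      fkSemigroup v L (t + T) (fun _ : Config N => (1 : ℝ≥0∞)) X < ⊤ :=
    Eventually.of_forall fun X => ENNReal.mul_lt_top (hS T X).lt_top (hS (t + T) X).lt_top
  simp_rw [hpt]
  rw [integral_const_mul, integral_toReal hmeas hfin, hchain, inv_mul_eq_div]

/-! ### (B) The integrated eigen-inequality of the finite-`T` witness -/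

/-- **(B) Integrated eigen-inequality at finite `T`.** For measurable `v : ℝ → [0,∞]` (hard cores
allowed), `T > 0` with `Z(T) = ‖e^{-TH}1‖₂² ≠ 0`, the witness `Ψ_T = e^{-TH}1/‖e^{-TH}1‖₂` satisfies
`⟨Ψ_T, e^{-tH}Ψ_T⟩ = Z(T + t/2)/Z(T) ≥ (Z(T)/Z(0))^{t/(2T)} = e^{-t E_T}` for all `t > 0`, with the
slope energy `E_T = log(Z(0)/Z(T))/(2T)` (log-convexity of `Z` by Cauchy–Schwarz and the semigroup
law; three-point inequality on the grids `T/n · ℕ`; `Z` antitone). [folklore] -/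
theorem stub_heig {N : ℕ} {v : ℝ → ℝ≥0∞} (hv : Measurable v) (L : ℝ) {T : ℝ} (hT : 0 < T)
    (h0 : fkNormSq (N := N) v L T (fun _ => 1) ≠ 0) {t : ℝ} (ht : 0 < t) :
    Real.exp (-(Real.log ((fkNormSq (N := N) v L 0 (fun _ => 1)).toReal /
        (fkNormSq (N := N) v L T (fun _ => 1)).toReal) / (2 * T) * t)) ≤
      ∫ X, fkWitness (N := N) v L T (fun _ => (1 : ℝ≥0∞)) X *
        fkReal v L t (fkWitness (N := N) v L T (fun _ => (1 : ℝ≥0∞))) X := by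
  have hne : ∀ s : ℝ, 0 ≤ s → fkNormSq (N := N) v L s (fun _ => (1 : ℝ≥0∞)) ≠ 0 :=
    fun s hs => fkNormSq_one_ne_zero hv L hT h0 hs
  have htop : ∀ s : ℝ, 0 ≤ s → fkNormSq (N := N) v L s (fun _ => (1 : ℝ≥0∞)) ≠ ⊤ :=
    fun s hs => ne_top_of_le_ne_top (volume_boxN_lt_top N L).ne (fkNormSq_one_le v hs)
  have hpos : ∀ s : ℝ, 0 ≤ s → 0 < (fkNormSq (N := N) v L s (fun _ => (1 : ℝ≥0∞))).toReal :=
    fun s hs => ENNReal.toReal_pos (hne s hs) (htop s hs)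
  -- the log-partition function `ℓ = log Z`
  obtain ⟨ℓ, hℓ⟩ : ∃ ℓ : ℝ → ℝ,
      ∀ s, ℓ s = Real.log (fkNormSq (N := N) v L s (fun _ => (1 : ℝ≥0∞))).toReal :=
    ⟨_, fun s => rfl⟩
  have hmid : ∀ a b : ℝ, 0 ≤ a → 0 ≤ b → 2 * ℓ ((a + b) / 2) ≤ ℓ a + ℓ b := by
    intro a b ha hb
    have h := fkNormSq_one_midpoint_sq_le (N := N) hv L ha hb
    have h' := ENNReal.toReal_mono (ENNReal.mul_ne_top (htop a ha) (htop b hb)) h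
    rw [ENNReal.toReal_pow, ENNReal.toReal_mul] at h'
    rw [hℓ, hℓ, hℓ, ← Real.log_mul (hpos a ha).ne' (hpos b hb).ne']
    calc 2 * Real.log (fkNormSq (N := N) v L ((a + b) / 2) (fun _ => (1 : ℝ≥0∞))).toReal
        = Real.log ((fkNormSq (N := N) v L ((a + b) / 2) (fun _ => (1 : ℝ≥0∞))).toReal ^ 2) := by
          rw [Real.log_pow]
          norm_num
      _ ≤ _ := Real.log_le_log (pow_pos (hpos _ (by linarith)) 2) h'
  have hanti : ∀ a b : ℝ, 0 ≤ a → a ≤ b → ℓ b ≤ ℓ a := by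
    intro a b ha hab
    rw [hℓ, hℓ]
    exact Real.log_le_log (hpos b (ha.trans hab))
      (ENNReal.toReal_mono (htop a ha) (fkNormSq_one_antitone hv L ha hab))
  have key := logConvex_slope_ineq hmid hanti hT ht
  rw [hℓ, hℓ, hℓ] at key
  rw [integral_fkWitness_mul_fkReal hv L hT.le h0 ht.le,
    Real.log_div (hpos 0 le_rfl).ne' (hpos T hT.le).ne']
  calc Real.exp (-((Real.log (fkNormSq (N := N) v L 0 (fun _ => (1 : ℝ≥0∞))).toReal -
          Real.log (fkNormSq (N := N) v L T (fun _ => (1 : ℝ≥0∞))).toReal) / (2 * T) * t))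
      ≤ Real.exp (Real.log (fkNormSq (N := N) v L (T + t / 2) (fun _ => (1 : ℝ≥0∞))).toReal -
          Real.log (fkNormSq (N := N) v L T (fun _ => (1 : ℝ≥0∞))).toReal) :=
        Real.exp_le_exp.2 key
    _ = (fkNormSq (N := N) v L (T + t / 2) (fun _ => (1 : ℝ≥0∞))).toReal /
          (fkNormSq (N := N) v L T (fun _ => (1 : ℝ≥0∞))).toReal := by
        rw [Real.exp_sub, Real.exp_log (hpos _ (by positivity)), Real.exp_log (hpos T hT.le)]

end Summit.AtomisticToContinuum.BoseEinsteinCondensation.Theorems.CutLineWitness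

end
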